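import Literature.AnabelianGeometry.EtaleTheta.ThetaSubquotientLevelN
import Literature.AnabelianGeometry.EtaleTheta.Discharge.Sec5ThetaSubquotientRhoOfConnectedTemperoid

/-!
# [EtTh] §5 over `B^temp(Π^tp_X)⁰`: the laws hpre / hgeom / hlift / hP of `(P, ρ)` at `B_N^bs` for the LEVEL-`N` genuine `(Q, P)` read off the §2 rigid data

Mochizuki, *The étale theta function and its Frobenioid-theoretic manifestations*, Publ. RIMS **45** (2009), §5 p. 327 (PDF p. 101) and the
proof of Prop. 5.5, pp. 327–328 (PDF pp. 101–102); §2 p. 46 ("`(l·Δ_Θ) ↠ (l·Δ_Θ) ⊗ ℤ/Nℤ ≅ μ_N`").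
[cite: MochizukiEtTh2009, Prop 5.5 p.327–328 (PDF pp.101–102)]

PROOF-ONLY (no definitions).  abc-iut cell, seat abc-iut-w4-d042 (gen 3), offer O1 (L2-lead GO-O1 2026-08-26T07:15Z) on the row «MERGE-PLAN row 2
(D) + G-w5d123-2 AT THE GENUINE (Q,P)».  With the level-`N` parameters `(q_N, ι_N)` of `ThetaSubquotientLevelN.lean` (constructed from abc-iut-L2-t2's
`RD : RigidData N l` and `ιX : RD.PiX ≃ₜ* Π^tp_X`; `Λ := μ_N`), abc-iut-L2-t9's carrier and `Aut`-projection `P_{B_N^bs} := autPre q_N ι_N ↠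
(l·Δ_Θ ⊗ ℤ/Nℤ)_{B_N^bs}` via `autProj` (`ThetaSubquotientOfTempered{,Galois,Aut}.lean`), and `ρ := rhoOfBiKummerData R ιX` over abc-iut-L2-t4's
`BiKummerSetting.mkOfConnectedTemperoid` (`Discharge/Sec5OfConnectedTemperoid.lean`) — read on the underlying `Π^tp_X`-set of `B_N^bs` through
`(connectedObjects _).ι.mapAut` as in `Discharge/Sec5ThetaSubquotientRhoOfConnectedTemperoid.lean` (p430025) — the binders that abc-iut-w5-d123's
`exists_eta_etaTautological_ofBiKummerData` (p418694) / abc-iut-w5-d020's `cyclotomicRigidity_ofBiKummerData_of_laws` (p420788) carry for the pair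
`(P, ρ)` become THEOREMS in the vocabulary of the §2 rigid data (`RD.lDeltaTheta`, `RD.thetaMod`, `RD.PiYdd`, `RD.aug`):

* **hpre** `mapAut_rho_mem_autPre_of_mem_lDeltaTheta` — `k ∈ (l·Δ_Θ) ⇒ ρ k ∈ P_{B_N^bs}`;
* **hgeom** `exists_mem_lDeltaTheta_mapAut_rho_eq_of_mem_autPre`, `autPre_le_map_mapAut_rho_lDeltaTheta`, `autPre_le_map_mapAut_rho_augKer` —
  EVERY element of `P_{B_N^bs}` is `ρ k` with `k ∈ (l·Δ_Θ) (≤ Ker aug)`;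
* **hlift** `exists_lift_rho_of_mem_autPre_lDeltaTheta` (inside any `H ⊇ ιX⁻¹(Stab x)`) and, for the §5 choice `A_⊙^bs := Ÿ`
  (`mkOfConnectedTemperoidYdd`), `exists_lift_rho_PiYdd_lDeltaTheta` — VERBATIM the binder `hlift`: `k₀ ∈ Π^tp_Ÿ`, `ρ k₀ ∈ P ⇒ ∃ k ∈ Π^tp_Ÿ ∩ (l·Δ_Θ)`,
  `ρ k = ρ k₀`;
* **hP at the base point** `evalAt_autProj_rho_eq_thetaMod_inv` — `autProj (ρ k)` evaluates at the base point `x = (s^⊓_N)^bs(x_{A_N})` to the class of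
  `(thetaMod k)⁻¹ ∈ μ_N`: the composite `(l·Δ_Θ) → P_{B_N^bs} ↠ (l·Δ_Θ ⊗ ℤ/Nℤ)_{B_N^bs} ≅ μ_N/J(Stab x)` IS `thetaMod` followed by inversion — so the
  consumers' coefficient map `e` is `m ↦ (evalEquiv x)⁻¹ [m⁻¹]` (mod `N` a bijection), the inversion being the passage `ρ(g)(x) = g⁻¹·x`
  of [SemiAnbd] Rmk. 3.1.3.

The instance `[RD.iotaN.range.Normal]` asked by the statements mentioning `autProj` / `evalAt` is `RigidData.iotaN_range_normal` (`haveI`).  Residual of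
GAP-LEDGER G-w5d123-2 after this file: only the PACKAGING of `⟨autPre, autProj⟩` as the `P : ThetaSubquotientProj 𝔉` argument (G-w4d042g3-1, v-next
interface) and the choice `Q := RD.levelStub ιX` inside `ofConnectedTemperoidData` (universe specialisation `V : FrdIMonoidStub.{max u₀ w}`).  Nothing of
[EtTh]'s curves is asserted; no side taken on [IUTchIII] Cor. 3.12.
-/

noncomputable section

namespace Literature.AnabelianGeometry.EtaleTheta

namespace ThetaFrobenioid

open CategoryTheory Opposite Literature.AlgebraicGeometry.Frobenioids Literature.AnabelianGeometry.SemiGraphs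
  Literature.AnabelianGeometry.SemiGraphs.GaloisObjects
open Literature.AlgebraicGeometry.Frobenioids.QuasiTemperoid (stabilizerSubgroup)

universe u₀ v₀ w

section Connected

variable {K : Type u₀} [Field K] {X : SemiGraphs.TemperedArithmeticGroup.{u₀} K} {D₀ : Type u₀} [Category.{v₀} D₀]
  {V : FrdIMonoidStub.{w}} {T₀ : RealifiedDivisorMonoids (D₀ := D₀) V}
  {VD : FrdICatStub.{u₀ + 1, u₀, w} (ConnectedPart (BTemp X.Pi))}
  {tf : TemperedFrobenioid T₀ (ConnectedPart (BTemp X.Pi)) VD} {hZ : tf.monoidType = MonoidType.Z}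
  {hP : ∀ A : (ConnectedPart (BTemp X.Pi))ᵒᵖ, IsPerfect (tf.Φ.carrier A)}
  {NH : Subgroup (Field.absoluteGaloisGroup K) → tf.category → ℕ+ → Prop} {A₀ : tf.category}
  {hA₀ : PreFrobenioid.IsFrobeniusTrivial tf.toElem A₀} {hA₀' : SemiGraphs.IsGaloisObj A₀.base.obj}
  {pullFrac : ∀ {A A' : (BiKummerSetting.mkOfConnectedTemperoid X tf hZ hP NH A₀ hA₀ hA₀').C} (_ : A' ⟶ A),
    (BiKummerSetting.mkOfConnectedTemperoid X tf hZ hP NH A₀ hA₀ hA₀').biratUnits A →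
      (BiKummerSetting.mkOfConnectedTemperoid X tf hZ hP NH A₀ hA₀ hA₀').biratUnits A'}
  {lv : ℕ+}
  {θ : (BiKummerSetting.mkOfConnectedTemperoid X tf hZ hP NH A₀ hA₀ hA₀').biratUnits
    (BiKummerSetting.mkOfConnectedTemperoid X tf hZ hP NH A₀ hA₀ hA₀').Aodot}
  {Bl : (BiKummerSetting.mkOfConnectedTemperoid X tf hZ hP NH A₀ hA₀ hA₀').C}
  {Pl : (BiKummerSetting.mkOfConnectedTemperoid X tf hZ hP NH A₀ hA₀ hA₀').FractionPair θ Bl}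
  {Rl : (BiKummerSetting.mkOfConnectedTemperoid X tf hZ hP NH A₀ hA₀ hA₀').NthRoot θ Pl lv pullFrac}
  {N : ℕ+} {l' : ℕ} {RD : RigidData.{max u₀ w} N l'}
  (R : (BiKummerSetting.mkOfConnectedTemperoid X tf hZ hP NH A₀ hA₀ hA₀').NthRoot Rl.root Rl.pair N pullFrac)
  (ιX : RD.PiX ≃ₜ* X.Pi)

/-- **hpre at the genuine level-`N` data**: `k ∈ (l·Δ_Θ) ⇒ ρ k ∈ P_{B_N^bs}` (`autPre q_N ι_N`), `ρ = rhoOfBiKummerData` read on the underlying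
`Π^tp_X`-set.  [cite: MochizukiEtTh2009, §5 p.327 (PDF p.101)] -/
theorem mapAut_rho_mem_autPre_of_mem_lDeltaTheta [RD.iotaN.range.Normal] (k : RD.PiX) (hk : k ∈ RD.lDeltaTheta) :
    ((Functor.mapAut R.BN.base (connectedObjects (BTemp X.Pi)).ι).comp (rhoOfBiKummerData R ιX)) k ∈
      ThetaSubquotient.autPre (RD.qN ιX) RD.iotaN R.BN.base.obj :=
  ThetaSubquotient.mem_autPre_of_rho_apply_base (RD.qN ιX) RD.iotaN ((BiKummerSetting.NthRoot.baseIso _ R).hom.hom.hom.hom (galoisBase X.isTempered R.AN.base.obj R.αData.isGalois))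
    ιX.toMonoidHom ((Functor.mapAut R.BN.base (connectedObjects (BTemp X.Pi)).ι).comp (rhoOfBiKummerData R ιX)) (rhoOfBiKummerData_obj_apply_base R ιX) R.BN.base.property k
    ((RD.qN_ιX_mem_range_iff ιX k).2 hk)

/-- The same for `k : Π^tp_Ÿ` (the binder shape of p420788's `hpre`). [cite: MochizukiEtTh2009, §5 p.327 (PDF p.101)] -/
theorem mapAut_rho_mem_autPre_of_coe_mem_lDeltaTheta [RD.iotaN.range.Normal] (k : RD.PiYdd) (hk : (k : RD.PiX) ∈ RD.lDeltaTheta) :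
    ((Functor.mapAut R.BN.base (connectedObjects (BTemp X.Pi)).ι).comp (rhoOfBiKummerData R ιX)) k ∈
      ThetaSubquotient.autPre (RD.qN ιX) RD.iotaN R.BN.base.obj :=
  mapAut_rho_mem_autPre_of_mem_lDeltaTheta R ιX (k : RD.PiX) hk

/-- **hgeom at the genuine level-`N` data, pointwise**: EVERY `σ ∈ P_{B_N^bs}` is `ρ k` for some `k ∈ (l·Δ_Θ)`.
[cite: MochizukiEtTh2009, §5 p.327 (PDF p.101)] -/
theorem exists_mem_lDeltaTheta_mapAut_rho_eq_of_mem_autPre {σ : Aut R.BN.base.obj}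
    (hσ : σ ∈ ThetaSubquotient.autPre (RD.qN ιX) RD.iotaN R.BN.base.obj) :
    ∃ k : RD.PiX, k ∈ RD.lDeltaTheta ∧
      ((Functor.mapAut R.BN.base (connectedObjects (BTemp X.Pi)).ι).comp (rhoOfBiKummerData R ιX)) k = σ := by
  obtain ⟨k, hk, h⟩ := ThetaSubquotient.exists_eq_rho_of_mem_autPre (RD.qN ιX) RD.iotaN ((BiKummerSetting.NthRoot.baseIso _ R).hom.hom.hom.hom (galoisBase X.isTempered R.AN.base.obj R.αData.isGalois))
    ιX.toMonoidHom ((Functor.mapAut R.BN.base (connectedObjects (BTemp X.Pi)).ι).comp (rhoOfBiKummerData R ιX)) (rhoOfBiKummerData_obj_apply_base R ιX) R.BN.base.property ιX.surjective hσ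
  exact ⟨k, (RD.qN_ιX_mem_range_iff ιX k).1 hk, h⟩

/-- **hgeom**: `P_{B_N^bs} ≤ ρ(l·Δ_Θ)`. [cite: MochizukiEtTh2009, §5 p.327 (PDF p.101)] -/
theorem autPre_le_map_mapAut_rho_lDeltaTheta :
    ThetaSubquotient.autPre (RD.qN ιX) RD.iotaN R.BN.base.obj ≤
      RD.lDeltaTheta.map ((Functor.mapAut R.BN.base (connectedObjects (BTemp X.Pi)).ι).comp (rhoOfBiKummerData R ιX)) := by
  intro σ hσ
  obtain ⟨k, hk, rfl⟩ := exists_mem_lDeltaTheta_mapAut_rho_eq_of_mem_autPre R ιX hσ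
  exact Subgroup.mem_map_of_mem _ hk

/-- **hgeom in the binder shape of p420788** (`P.pre ≤ ρ(Ker aug)`): `(l·Δ_Θ) ≤ Δ^tp_X = Ker(Π^tp_X ↠ G_K)` (`lDeltaTheta_le`).
[cite: MochizukiEtTh2009, §2 p.45; Prop 2.14 (i) p.49] -/
theorem autPre_le_map_mapAut_rho_augKer :
    ThetaSubquotient.autPre (RD.qN ιX) RD.iotaN R.BN.base.obj ≤
      RD.aug.ker.map ((Functor.mapAut R.BN.base (connectedObjects (BTemp X.Pi)).ι).comp (rhoOfBiKummerData R ιX)) :=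
  (autPre_le_map_mapAut_rho_lDeltaTheta R ιX).trans
    (Subgroup.map_mono (RD.lDeltaTheta_le.trans inf_le_right))

/-- Reading `ρ` on the underlying `Π^tp_X`-set is faithful: `Aut_D(B_N^bs) → Aut(B_N^bs.obj)` is injective (full subcategory).
[cite: MochizukiEtTh2009, §5 p.331 (PDF p.105)] -/
theorem rho_eq_of_mapAut_rho_eq {a b : RD.PiX} (h : ((Functor.mapAut R.BN.base (connectedObjects (BTemp X.Pi)).ι).comp (rhoOfBiKummerData R ιX)) a = ((Functor.mapAut R.BN.base (connectedObjects (BTemp X.Pi)).ι).comp (rhoOfBiKummerData R ιX)) b) :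
    rhoOfBiKummerData R ιX a = rhoOfBiKummerData R ιX b :=
  Iso.ext (ObjectProperty.hom_ext _ (congrArg Iso.hom h))

/-- **hlift at the genuine level-`N` data** inside any `H ≤ Π^tp_X` containing `ιX⁻¹(Stab x) = Ker ρ`: an element `ρ k₀ ∈ P_{B_N^bs}` with
`k₀ ∈ H` lifts to `k ∈ H ∩ (l·Δ_Θ)` with `ρ k = ρ k₀`.  [cite: MochizukiEtTh2009, Prop 5.5 proof p.327–328 (PDF pp.101–102)] -/
theorem exists_lift_rho_of_mem_autPre_lDeltaTheta (H : Subgroup RD.PiX)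
    (hH : (stabilizerSubgroup R.BN.base.obj
        ((BiKummerSetting.NthRoot.baseIso _ R).hom.hom.hom.hom (galoisBase X.isTempered R.AN.base.obj R.αData.isGalois))).comap
      ιX.toMonoidHom ≤ H)
    {k₀ : RD.PiX} (hk₀ : k₀ ∈ H)
    (hm : ((Functor.mapAut R.BN.base (connectedObjects (BTemp X.Pi)).ι).comp (rhoOfBiKummerData R ιX)) k₀ ∈
      ThetaSubquotient.autPre (RD.qN ιX) RD.iotaN R.BN.base.obj) :
    ∃ k ∈ H, k ∈ RD.lDeltaTheta ∧ rhoOfBiKummerData R ιX k = rhoOfBiKummerData R ιX k₀ := by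
  obtain ⟨k, hk, hq, he⟩ := ThetaSubquotient.exists_lift_of_rho_mem_autPre (RD.qN ιX) RD.iotaN ((BiKummerSetting.NthRoot.baseIso _ R).hom.hom.hom.hom (galoisBase X.isTempered R.AN.base.obj R.αData.isGalois))
    ιX.toMonoidHom ((Functor.mapAut R.BN.base (connectedObjects (BTemp X.Pi)).ι).comp (rhoOfBiKummerData R ιX)) (rhoOfBiKummerData_obj_apply_base R ιX) R.BN.base.property ιX.surjective H hH hk₀ hm
  exact ⟨k, hk, (RD.qN_ιX_mem_range_iff ιX k).1 hq, rho_eq_of_mapAut_rho_eq R ιX he⟩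

/-- **hP at the genuine level-`N` data (base point)**: for `k ∈ (l·Δ_Θ)`, `autProj (ρ k)` evaluates at the base point `x = (s^⊓_N)^bs(x_{A_N})` of
`B_N^bs` to the class of `(thetaMod k)⁻¹ ∈ μ_N` in `μ_N / J(Stab x)` — the composite `(l·Δ_Θ) → P_{B_N^bs} ↠ (l·Δ_Θ ⊗ ℤ/Nℤ)_{B_N^bs}
≅ μ_N/J(Stab x)` IS "`(l·Δ_Θ) ↠ (l·Δ_Θ) ⊗ ℤ/Nℤ ≅ μ_N`" (p.46) followed by inversion.  [cite: MochizukiEtTh2009, §5 p.327 (PDF p.101); §2 p.46] -/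
theorem evalAt_autProj_rho_eq_thetaMod_inv [RD.iotaN.range.Normal] (k : RD.PiX) (hk : k ∈ RD.lDeltaTheta)
    (hm : ((Functor.mapAut R.BN.base (connectedObjects (BTemp X.Pi)).ι).comp (rhoOfBiKummerData R ιX)) k ∈
      ThetaSubquotient.autPre (RD.qN ιX) RD.iotaN R.BN.base.obj) :
    ThetaSubquotient.evalAt (RD.qN ιX) RD.iotaN R.BN.base.obj
        ((BiKummerSetting.NthRoot.baseIso _ R).hom.hom.hom.hom (galoisBase X.isTempered R.AN.base.obj R.αData.isGalois))
        (ThetaSubquotient.autProj (RD.qN ιX) RD.iotaN R.BN.base.obj ⟨_, hm⟩) =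
      QuotientGroup.mk (RD.thetaMod ⟨k, hk⟩)⁻¹ := by
  refine ThetaSubquotient.evalAt_autProj_rho (RD.qN ιX) RD.iotaN ((BiKummerSetting.NthRoot.baseIso _ R).hom.hom.hom.hom (galoisBase X.isTempered R.AN.base.obj R.αData.isGalois))
    ιX.toMonoidHom ((Functor.mapAut R.BN.base (connectedObjects (BTemp X.Pi)).ι).comp (rhoOfBiKummerData R ιX)) (rhoOfBiKummerData_obj_apply_base R ιX) k _ ?_ hm
  change RD.iotaN (RD.thetaMod ⟨k, hk⟩)⁻¹ = RD.qN ιX (ιX k)⁻¹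
  rw [map_inv, map_inv, RD.qN_ιX_eq_iotaN_thetaMod ιX k hk]

end Connected

section Ydd

variable {K : Type u₀} [Field K] {X : SemiGraphs.TemperedArithmeticGroup.{u₀} K} {D₀ : Type u₀} [Category.{v₀} D₀]
  {V : FrdIMonoidStub.{w}} {T₀ : RealifiedDivisorMonoids (D₀ := D₀) V}
  {VD : FrdICatStub.{u₀ + 1, u₀, w} (ConnectedPart (BTemp X.Pi))}
  {tf : TemperedFrobenioid T₀ (ConnectedPart (BTemp X.Pi)) VD} {hZ : tf.monoidType = MonoidType.Z}
  {hP : ∀ A : (ConnectedPart (BTemp X.Pi))ᵒᵖ, IsPerfect (tf.Φ.carrier A)}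
  {NH : Subgroup (Field.absoluteGaloisGroup K) → tf.category → ℕ+ → Prop}
  {lv N : ℕ+} {l' : ℕ} {RD : RigidData.{max u₀ w} N l'} {ιX : RD.PiX ≃ₜ* X.Pi}
  {pullFrac : ∀ {A A' : (BiKummerSetting.mkOfConnectedTemperoidYdd X tf hZ hP NH RD.toThetaEnvData ιX).C} (_ : A' ⟶ A),
    (BiKummerSetting.mkOfConnectedTemperoidYdd X tf hZ hP NH RD.toThetaEnvData ιX).biratUnits A →
      (BiKummerSetting.mkOfConnectedTemperoidYdd X tf hZ hP NH RD.toThetaEnvData ιX).biratUnits A'}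
  {θ : (BiKummerSetting.mkOfConnectedTemperoidYdd X tf hZ hP NH RD.toThetaEnvData ιX).biratUnits
    (BiKummerSetting.mkOfConnectedTemperoidYdd X tf hZ hP NH RD.toThetaEnvData ιX).Aodot}
  {Bl : (BiKummerSetting.mkOfConnectedTemperoidYdd X tf hZ hP NH RD.toThetaEnvData ιX).C}
  {Pl : (BiKummerSetting.mkOfConnectedTemperoidYdd X tf hZ hP NH RD.toThetaEnvData ιX).FractionPair θ Bl}
  {Rl : (BiKummerSetting.mkOfConnectedTemperoidYdd X tf hZ hP NH RD.toThetaEnvData ιX).NthRoot θ Pl lv pullFrac}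
  (R : (BiKummerSetting.mkOfConnectedTemperoidYdd X tf hZ hP NH RD.toThetaEnvData ιX).NthRoot Rl.root Rl.pair N pullFrac)

/-- **hlift VERBATIM at the genuine level-`N` data with `A_⊙^bs := Ÿ`** (the binder `hlift` of p418694 / p420788 read with `P.pre := autPre.comap mapAut`):
an element of `H_{B_N} = ρ(Π^tp_Ÿ)` lying in `P_{B_N^bs}` lifts to `Π^tp_Ÿ ∩ (l·Δ_Θ)` — NO residual subgroup hypothesis (`ιX⁻¹(Stab x) ≤ Π^tp_Ÿ`:
`stabilizer_base_comap_le_PiYdd`).  [cite: MochizukiEtTh2009, Prop 5.5 proof p.327–328 (PDF pp.101–102)] -/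
theorem exists_lift_rho_PiYdd_lDeltaTheta (k₀ : RD.PiYdd)
    (hm : ((Functor.mapAut R.BN.base (connectedObjects (BTemp X.Pi)).ι).comp (rhoOfBiKummerData R ιX)) k₀ ∈
      ThetaSubquotient.autPre (RD.qN ιX) RD.iotaN R.BN.base.obj) :
    ∃ k : RD.PiYdd, (k : RD.PiX) ∈ RD.lDeltaTheta ∧ rhoOfBiKummerData R ιX k = rhoOfBiKummerData R ιX k₀ := by
  obtain ⟨k, hk, hq, he⟩ := ThetaSubquotient.exists_lift_of_rho_mem_autPre (RD.qN ιX) RD.iotaN ((BiKummerSetting.NthRoot.baseIso _ R).hom.hom.hom.hom (galoisBase X.isTempered R.AN.base.obj R.αData.isGalois))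
    ιX.toMonoidHom ((Functor.mapAut R.BN.base (connectedObjects (BTemp X.Pi)).ι).comp (rhoOfBiKummerData R ιX)) (rhoOfBiKummerData_obj_apply_base R ιX) R.BN.base.property ιX.surjective RD.PiYdd (stabilizer_base_comap_le_PiYdd R) k₀.2 hm
  exact ⟨⟨k, hk⟩, (RD.qN_ιX_mem_range_iff ιX k).1 hq, Iso.ext (ObjectProperty.hom_ext _ (congrArg Iso.hom he))⟩

end Ydd

end ThetaFrobenioid

end Literature.AnabelianGeometry.EtaleTheta
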